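import Mathlib
import HarnessLib
import Literature.Probability.MarkovChains.GroupRandomWalk
import Literature.Probability.MarkovChains.LpDistance
import Literature.Probability.MarkovChains.NashInequality

/-!
# From `L²` to `L^∞` at half time, without reversibility: `|k(x,y,m+n) − 1| = |⟨k(x,·,m) − 1, k*(y,·,n) − 1⟩_π| ≤ d_{2,π}(K_m(x,·),π)·d_{2,π}(K*_n(y,·),π)` (Goel–Montenegro–Tetali 2006, eq. (L∞))

HONEST FRAMING: exact (Metropolis-corrected) sampling algorithms for lattice gauge theory; figures
of merit are autocorrelation/cost numbers at stated couplings and volumes; no continuum-physics claim.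

Source (READ on the hub's materialised text): S. Goel, R. Montenegro, P. Tetali, *Mixing time
bounds via the spectral profile*, Electron. J. Probab. **11** (2006) 1–26 = math.PR/0505690
[GoelMontenegroTetali2006], §2.1, proof of Theorem 1.1, the display labelled (L∞):
`|(H_t(x,y) − π(y))/π(y)| = |Σ_z (H_{t/2}(x,z) − π(z))(H_{t/2}(z,y) − π(y))/π(y)| =
|Σ_z π(z)(H_{t/2}(x,z)/π(z) − 1)(H*_{t/2}(y,z)/π(z) − 1)| ≤ d_{2,π}(H_{t/2}(x,·),π)·d_{2,π}(H*_{t/2}(y,·),π)`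
"where the inequality follows from Cauchy–Schwartz", and its discrete-time use in §2.3, proof of
Corollary 2.1: "As in Theorem 1.1, `|k(x,y,2n) − 1| ≤ d_{2,π}(K_n(x,·),π)·d_{2,π}(K*_n(y,·),π)`".
Vendored here for any splitting of the time (`s + t`, resp. `m + n`; the printed `t/2 + t/2` is the
symmetric split), in CONTINUOUS time for the heat kernel `H_t = e^{−rt(I−K)}` of
`HeatKernelVarianceDecay.lean` (the printed setting, `r = 1`) and in DISCRETE time for `K_n`
(its use in Corollary 2.1); everything is PROVED (finite sums; 0 named facts).  The REVERSIBLE special case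
`K* = K` is Levin–Peres–Wilmer eqs. (4.40)–(4.42), already in `LpDistance.lean`
(`LevinPeres2017_eq_4_40` / `_4_42`), and the TOTAL-VARIATION sibling `q_{s+t}(x,y) − 1 =
Σ_z (Pˢ(x,z) − π(z))(q_t(z,y) − 1)` (their Lemma 4.18) is `LpDistanceSubmultiplicative.lean`
(`relDensity_add_sub_one`, `lInfDist_add_le`); in continuous time the same identity with the
COLUMN density `H_s(·,y)/π(y)` and `s = t` is `piInner_density_sub_one` of `NashInequality.lean`
(Saloff-Coste 1997, proof of Corollary 2.1.5).  This file is the `π`-weighted ADJOINT-CHAIN form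
(`H*_t(y,·)/π(·) = H_t(·,y)/π(y)` as a row density of `K*`, to which row bounds such as THEOREM 2.1 /
THEOREM 2.2 apply verbatim), for any split `s + t`.

VOCABULARY (the tree's): `K = P`, `K* = timeReversal π P` (`K*(x,y) = π(y)K(y,x)/π(x)`,
`GroupRandomWalk.lean`), `k(x,y,n) = Kⁿ(x,y)/π(y) = relDensity P π n x y`, `⟨·,·⟩_π = piInner π`,
`d⁽²⁾(n) = sup_x ‖k(x,·,n) − 1‖_{2,π} = lTwoDist P π n`, `d⁽∞⁾(n) = sup_{x,y} |k(x,y,n) − 1| =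
lInfDist P π n` (`LpDistance.lean`); `H_t = heatKernel P r t`, `h_t(x,y) = H_t(x,y)/π(y)`, and the
adjoint heat kernel `H*_t = heatKernel (timeReversal π P) r t` with `π(x)H_t(x,y) = π(y)H*_t(y,x)`
(`mul_heatKernel_eq_mul_heatKernel_timeReversal`, `NashInequality.lean`).

## Content
* continuous time: `heatKernel_add_div_eq_piInner` (`h_{s+t}(x,y) = ⟨h_s(x,·), h*_t(y,·)⟩_π`),
  `heatKernel_add_div_sub_one_eq_piInner` (**the identity of (L∞)**) and
  `GoelMontenegroTetali2006_abs_heatKernel_div_sub_one_le` (**(L∞): `|h_{s+t}(x,y) − 1| ≤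
  ‖h_s(x,·) − 1‖_{2,π}·‖h*_t(y,·) − 1‖_{2,π}`**);
* discrete time: `relDensity_add_eq_piInner` (`k(x,y,m+n) = ⟨k(x,·,m), k*(y,·,n)⟩_π`, from `π(z)Kⁿ(z,y) =
  π(y)K*ⁿ(y,z)`), `relDensity_add_sub_one_eq_piInner` (**the identity of (L∞)**),
  `GoelMontenegroTetali2006_abs_relDensity_add_sub_one_le` (**the Cauchy–Schwarz bound of (L∞)**),
  `GoelMontenegroTetali2006_lInfDist_add_le` (**`d⁽∞⁾_K(m+n) ≤ d⁽²⁾_K(m)·d⁽²⁾_{K*}(n)`**) and the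
  printed half-time form `GoelMontenegroTetali2006_lInfDist_two_mul_le`.
-/

namespace Literature.Probability.MarkovChains

open Finset Matrix

variable {X : Type*} [Fintype X] [DecidableEq X] {P : Matrix X X ℝ} {π : X → ℝ}

/-! ## Continuous time: the display (L∞) -/

section Continuous

/-- **`h_{s+t}(x,y) = Σ_z π(z) h_s(x,z) h*_t(y,z)`** (`H_{s+t} = H_sH_t` and `π(z)H_t(z,y) =
π(y)H*_t(y,z)`). [cite: GoelMontenegroTetali2006, §2.1 proof of Theorem 1.1, display (L∞) (first two
equalities)] -/
theorem heatKernel_add_div_eq_piInner (hπ : ∀ z, 0 < π z) (r s t : ℝ) (x y : X) :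
    heatKernel P r (s + t) x y / π y =
      piInner π (fun z => heatKernel P r s x z / π z)
        (fun z => heatKernel (timeReversal π P) r t y z / π z) := by
  have hπ0 : ∀ z, π z ≠ 0 := fun z => (hπ z).ne'
  rw [heatKernel_semigroup, Matrix.mul_apply, sum_div]
  refine sum_congr rfl fun z _ => ?_
  have h := mul_heatKernel_eq_mul_heatKernel_timeReversal (P := P) hπ0 r t z y
  have hz := hπ0 z
  have hy := hπ0 y
  field_simp
  linear_combination (heatKernel P r s x z) * h

/-- **The identity of (L∞) in continuous time: `h_{s+t}(x,y) − 1 = ⟨h_s(x,·) − 1, h*_t(y,·) − 1⟩_π`**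
(`Σ_z H_s(x,z) = 1 = Σ_z H*_t(y,z)`, `Σ π = 1`; `K` row-stochastic, `πK = π`, `π > 0`).
[cite: GoelMontenegroTetali2006, §2.1 proof of Theorem 1.1, display (L∞); Saloffcoste1997, §2.1.2
proof of Corollary 2.1.5 (`|h_t(x,y) − 1| = |Σ_z (h_{t/2}(x,z) − 1)(h*_{t/2}(y,z) − 1)π(z)|`)] -/
theorem heatKernel_add_div_sub_one_eq_piInner (hP : IsRowStochastic P) (hst : IsStationary π P)
    (hπ : ∀ z, 0 < π z) (hπ1 : ∑ z, π z = 1) (r s t : ℝ) (x y : X) :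
    heatKernel P r (s + t) x y / π y - 1 =
      piInner π (fun z => heatKernel P r s x z / π z - 1)
        (fun z => heatKernel (timeReversal π P) r t y z / π z - 1) := by
  have h1 : ∑ z, π z * (heatKernel P r s x z / π z) = 1 := by
    rw [← sum_heatKernel hP r s x]
    exact sum_congr rfl fun z _ => mul_div_cancel₀ _ (hπ z).ne'
  have h2 : ∑ z, π z * (heatKernel (timeReversal π P) r t y z / π z) = 1 := by
    rw [← sum_heatKernel (timeReversal_isRowStochastic hπ hP hst) r t y]
    exact sum_congr rfl fun z _ => mul_div_cancel₀ _ (hπ z).ne'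
  rw [heatKernel_add_div_eq_piInner hπ]
  simp only [piInner, mul_sub, sub_mul, mul_one, one_mul, sum_sub_distrib]
  rw [h1, h2, hπ1]
  have e : ∑ z, π z * (heatKernel P r s x z / π z) * (heatKernel (timeReversal π P) r t y z / π z) =
      ∑ z, π z * (heatKernel P r s x z / π z * (heatKernel (timeReversal π P) r t y z / π z)) :=
    sum_congr rfl fun z _ => by ring
  linarith [e]

/-- **(L∞) (Goel–Montenegro–Tetali 2006): `|h_{s+t}(x,y) − 1| ≤ ‖h_s(x,·) − 1‖_{2,π} ·
‖h*_t(y,·) − 1‖_{2,π} = d_{2,π}(H_s(x,·),π)·d_{2,π}(H*_t(y,·),π)`** ("where the inequality follows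
from Cauchy–Schwartz"; printed with `s = t = t/2`).  Any `L²` bound available for `H` AND `H*` at half
time (e.g. THEOREM 2.1, which "we can apply to either `H_t` or `H_t*`") thus gives the uniform bound.
[cite: GoelMontenegroTetali2006, §2.1 proof of Theorem 1.1, display (L∞)] -/
theorem GoelMontenegroTetali2006_abs_heatKernel_div_sub_one_le (hP : IsRowStochastic P)
    (hst : IsStationary π P) (hπ : ∀ z, 0 < π z) (hπ1 : ∑ z, π z = 1) (r s t : ℝ) (x y : X) :
    |heatKernel P r (s + t) x y / π y - 1| ≤
      Real.sqrt (piInner π (fun z => heatKernel P r s x z / π z - 1)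
          (fun z => heatKernel P r s x z / π z - 1)) *
        Real.sqrt (piInner π (fun z => heatKernel (timeReversal π P) r t y z / π z - 1)
          (fun z => heatKernel (timeReversal π P) r t y z / π z - 1)) := by
  have hπ0 : ∀ z, 0 ≤ π z := fun z => (hπ z).le
  rw [heatKernel_add_div_sub_one_eq_piInner hP hst hπ hπ1,
    ← Real.sqrt_mul (piInner_self_nonneg hπ0 _), ← Real.sqrt_sq_eq_abs]
  exact Real.sqrt_le_sqrt (piInner_sq_le_mul hπ0 _ _)

end Continuous

/-! ## Discrete time: `K_{m+n}` -/

/-- **`k(x,y,m+n) = Σ_z π(z) k(x,z,m) k*(y,z,n)`** (`K^{m+n} = K^m K^n` and `π(z)Kⁿ(z,y) =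
π(y)(K*)ⁿ(y,z)`). [cite: GoelMontenegroTetali2006, §2.1 proof of Theorem 1.1, display (L∞) (first
two equalities)] -/
theorem relDensity_add_eq_piInner (hπ : ∀ z, 0 < π z) (m n : ℕ) (x y : X) :
    relDensity P π (m + n) x y =
      piInner π (relDensity P π m x) (relDensity (timeReversal π P) π n y) := by
  have hπ0 : ∀ z, π z ≠ 0 := fun z => (hπ z).ne'
  simp only [piInner, relDensity_apply, kernelAt_eq_pow_apply]
  rw [pow_add, Matrix.mul_apply, sum_div]
  refine sum_congr rfl fun z _ => ?_
  have h := LevinPeres2017_prop_1_23_pow hπ0 P n z y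
  -- `(Kᵐ)(x,z)(Kⁿ)(z,y)/π(y) = π(z)·(Kᵐ(x,z)/π(z))·((K*)ⁿ(y,z)/π(z))`
  have hz := hπ0 z
  have hy := hπ0 y
  field_simp
  linear_combination ((P ^ m) x z) * h

/-- **The identity of (L∞): `k(x,y,m+n) − 1 = ⟨k(x,·,m) − 1, k*(y,·,n) − 1⟩_π`** (`Σ_z π(z)k(x,z,m)
= 1 = Σ_z π(z)k*(y,z,n)`, `Σ π = 1`; `K` row-stochastic with `πK = π`, `π > 0`).
[cite: GoelMontenegroTetali2006, §2.1 proof of Theorem 1.1, display (L∞); §2.3 proof of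
Corollary 2.1 ("As in Theorem 1.1")] -/
theorem relDensity_add_sub_one_eq_piInner (hP : IsRowStochastic P) (hst : IsStationary π P)
    (hπ : ∀ z, 0 < π z) (hπ1 : ∑ z, π z = 1) (m n : ℕ) (x y : X) :
    relDensity P π (m + n) x y - 1 =
      piInner π (fun z => relDensity P π m x z - 1)
        (fun z => relDensity (timeReversal π P) π n y z - 1) := by
  have h1 : ∑ z, π z * relDensity P π m x z = 1 := by
    simpa only [mul_comm] using sum_relDensity_mul hP hπ m x
  have h2 : ∑ z, π z * relDensity (timeReversal π P) π n y z = 1 := by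
    simpa only [mul_comm] using
      sum_relDensity_mul (timeReversal_isRowStochastic hπ hP hst) hπ n y
  rw [relDensity_add_eq_piInner hπ]
  simp only [piInner, mul_sub, sub_mul, mul_one, one_mul, sum_sub_distrib]
  rw [h1, h2, hπ1]
  have e : ∑ z, π z * relDensity P π m x z * relDensity (timeReversal π P) π n y z =
      ∑ z, π z * (relDensity P π m x z * relDensity (timeReversal π P) π n y z) :=
    sum_congr rfl fun z _ => by ring
  linarith [e]

/-- **The bound of (L∞): `|k(x,y,m+n) − 1| ≤ ‖k(x,·,m) − 1‖_{2,π} · ‖k*(y,·,n) − 1‖_{2,π}`**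
("the inequality follows from Cauchy–Schwartz"). [cite: GoelMontenegroTetali2006, §2.1 proof of
Theorem 1.1, display (L∞); §2.3 proof of Corollary 2.1] -/
theorem GoelMontenegroTetali2006_abs_relDensity_add_sub_one_le (hP : IsRowStochastic P)
    (hst : IsStationary π P) (hπ : ∀ z, 0 < π z) (hπ1 : ∑ z, π z = 1) (m n : ℕ) (x y : X) :
    |relDensity P π (m + n) x y - 1| ≤
      Real.sqrt (piInner π (fun z => relDensity P π m x z - 1) (fun z => relDensity P π m x z - 1)) *
        Real.sqrt (piInner π (fun z => relDensity (timeReversal π P) π n y z - 1)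
          (fun z => relDensity (timeReversal π P) π n y z - 1)) := by
  have hπ0 : ∀ z, 0 ≤ π z := fun z => (hπ z).le
  rw [relDensity_add_sub_one_eq_piInner hP hst hπ hπ1, ← Real.sqrt_mul (piInner_self_nonneg hπ0 _),
    ← Real.sqrt_sq_eq_abs]
  exact Real.sqrt_le_sqrt (piInner_sq_le_mul hπ0 _ _)

/-- **`d⁽∞⁾_K(m+n) ≤ d⁽²⁾_K(m) · d⁽²⁾_{K*}(n)`**: "since we can apply Theorem 2.2 to either `K` or `K*`",
the `L²` bounds at the two half times give the uniform bound. [cite: GoelMontenegroTetali2006, §2.1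
proof of Theorem 1.1 ((L∞) and the sentence after it); §2.3 proof of Corollary 2.1] -/
theorem GoelMontenegroTetali2006_lInfDist_add_le (hP : IsRowStochastic P) (hst : IsStationary π P)
    (hπ : ∀ z, 0 < π z) (hπ1 : ∑ z, π z = 1) (m n : ℕ) :
    lInfDist P π (m + n) ≤ lTwoDist P π m * lTwoDist (timeReversal π P) π n := by
  have h0 : 0 ≤ lTwoDist P π m * lTwoDist (timeReversal π P) π n :=
    mul_nonneg (lTwoDist_nonneg _ _ _) (lTwoDist_nonneg _ _ _)
  rcases isEmpty_or_nonempty X with hX | hX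
  · simp only [lInfDist, Real.iSup_of_isEmpty]; exact h0
  refine ciSup_le fun x => ciSup_le fun y => ?_
  refine (GoelMontenegroTetali2006_abs_relDensity_add_sub_one_le hP hst hπ hπ1 m n x y).trans ?_
  exact mul_le_mul (norm_le_lTwoDist _ _ _ _) (norm_le_lTwoDist _ _ _ _) (Real.sqrt_nonneg _)
    (lTwoDist_nonneg _ _ _)

/-- **Half-time form, as printed: `sup_{x,y} |k(x,y,2n) − 1| ≤ d⁽²⁾_K(n) · d⁽²⁾_{K*}(n)`**.
[cite: GoelMontenegroTetali2006, §2.3 proof of Corollary 2.1 ("`|k(x,y,2n) − 1| ≤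
d_{2,π}(K_n(x,·),π) d_{2,π}(K*_n(y,·),π)`")] -/
theorem GoelMontenegroTetali2006_lInfDist_two_mul_le (hP : IsRowStochastic P)
    (hst : IsStationary π P) (hπ : ∀ z, 0 < π z) (hπ1 : ∑ z, π z = 1) (n : ℕ) :
    lInfDist P π (2 * n) ≤ lTwoDist P π n * lTwoDist (timeReversal π P) π n := by
  rw [two_mul]; exact GoelMontenegroTetali2006_lInfDist_add_le hP hst hπ hπ1 n n

end Literature.Probability.MarkovChains
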